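import Summits.AtomisticToContinuum.Crystallization.Theorems.LoopTunnelDialThinAnatomy
import Summits.AtomisticToContinuum.Crystallization.Theorems.ChargedEnergyGap.Negative.Unconditional

/-!
# LoopTunnelDial — the COHESION DIAL beneath TENUOUS (lens-5 generation 21; crux `PocketCase`, stmt-AtomisticToContinuum-27294)

Landing-kit file 9 (lands after kit 5 `LoopTunnelDialThinAnatomy`; independent of kit 8), §1–§4; §5 (the concordance BY TEXT with
route `CohesionFrustrationStrain`'s crux `Cohesion`) is the companion module `LoopTunnelDialCohesionDialVacuum`.  All `[folklore]`; 0 sorry.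

The declared residual core TENUOUS (`TenuousCertified s`: certify every large ground state that is ALL-FAR and everywhere
`s`-SPARSE) is read through ONE new object, the HOLE SCALE.  Three facts, all proved here:

* **Packing lemma** (`exposed_of_card_lt`, pure measure theory): if the closed `s`-ball about a particle holds fewer than `s³`
  particles, then for every hole scale `0 < r₀` with `s·r₀ ≤ s − r₀` (i.e. `r₀ ≤ s/(s+1)`; at `s = 32`: `r₀ ≤ 32/33`) some point
  within `s − r₀` of that particle is at distance `≥ r₀` from EVERY particle — the particle is `(r₀, s − r₀)`-EXPOSED in the exact
  sense of route `SurfaceTensionNoFoam` (`ExposedSitesCost` 13448 / `NoFoam` 13453).  Hence every particle of an `s`-sparse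
  configuration is exposed (`exposed_of_sparse`): sparse matter is foam at hole scale `s/(s+1)`.
* **Cohesion kills TENUOUS with no sieve** (`tenuousCertified_of_noSparseGS`): `NoSparseGS s` — beyond some particle number no
  Lennard-Jones ground state is everywhere `s`-sparse — makes the TENUOUS world empty; it mentions neither `AllFar`, nor the
  `(2, 3/50)` sieve, nor `e⋆`, nor a surgery.  With TOUCH it gives THIN (`thinCertified_of_touch_noSparse`, Earnshaw discharged).
* **The exposed-sites currency at FIXED hole scale suffices** (`noSparseGS_of_costAt`): `ExposedSitesCostAt r₀` — item 13448's
  inequality `c(R)·#{(r₀,R)-exposed} ≤ E(N) − N·e⋆` at a FIXED `r₀` instead of `∃ r₀` — together with the LANDED energy limit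
  `E(N)/N → e⋆` (`ChargedEnergyGapNegative.crysEnergyLimit`, item 0626) forces the exposed fraction to vanish uniformly
  (`fractionSmall_of_costAt`), hence a cohesive core (`cohesiveCore_of_fractionSmall`), hence `NoSparseGS s` for every
  `r₀ ≤ s/(s+1)`.  At the frozen numeral: `ExposedSitesCostAt (32/33) → NoSparseGS 32` (`noSparseGS32_of_costAt`).

Direction of the hole scale (why 13448 / 13453 AS TYPED do not plug in by name): exposure is ANTITONE in `r₀`
(`exposed_anti`, `costAt_mono`) — `ExposedSitesCostAt r₀ → ExposedSitesCostAt r₁` for `r₀ ≤ r₁` — so the `∃ r₀` of 13448 may be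
witnessed at a hole scale LARGER than `32/33`, where `32`-sparse matter need not be exposed; a proof of 13448 with witness
`r₀ ≤ 32/33` closes TENUOUS (and `ExposedSitesCostAt r₀ → ExposedSitesCost` for every `0 < r₀`, one line in the route-level
concordance file).  `¬ Sparse s y` is literally the FILLING clause `s³ ≤ #B̄(y c, s)` of `DeepFar s y c` at some particle
(`not_sparse_iff`).
-/

noncomputable section

open scoped BigOperators Classical Topology
open Filter MeasureTheory
open Literature.MathematicalPhysics.StatisticalMechanics
open Summit.AtomisticToContinuum.Crystallization.Theorems.GrainPercolationDialCrossCeiling (E3 ballChunk ballChunk_card_le)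
open Summit.AtomisticToContinuum.Crystallization.Theorems.LjLaminarWindowsSketch (lennardJones_groundState_dist_ge_seven_tenths)
open Summit.AtomisticToContinuum.Crystallization.Theorems.ChargedEnergyGapNegative (eStar crysEnergyLimit)
open Summit.AtomisticToContinuum.Crystallization.Theorems.LoopTunnelDialSieveCurrency
open Summit.AtomisticToContinuum.Crystallization.Theorems.LoopTunnelDialThinAnatomy

namespace Summit.AtomisticToContinuum.Crystallization.Theorems.LoopTunnelDialCohesionDial

variable {N : ℕ}

/-! ## §1 Exposure at a hole scale -/

/-- **`Exposed r₀ R y i`** — particle `i` is `(r₀, R)`-EXPOSED: some point within distance `R` of `y i` lies at distance `≥ r₀` from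
every particle (an empty open `r₀`-ball centred within `R`).  VERBATIM the exposure predicate of `SurfaceTensionNoFoam.ExposedSitesCost`
/ `NoFoam`. [line vocabulary · LoopTunnelDial cohesion dial · crux stmt-AtomisticToContinuum-27294 · definition, not a cited fact] -/
def Exposed (r₀ R : ℝ) {N : ℕ} (y : Fin N → E3) (i : Fin N) : Prop :=
  ∃ p : E3, dist p (y i) ≤ R ∧ ∀ j : Fin N, r₀ ≤ dist p (y j)

/-- Exposure is ANTITONE in the hole scale: a bigger empty ball is a smaller one. -/
theorem exposed_anti {r₀ r₁ R : ℝ} (h : r₀ ≤ r₁) {y : Fin N → E3} {i : Fin N} (hi : Exposed r₁ R y i) :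
    Exposed r₀ R y i := by
  obtain ⟨p, hp, hfar⟩ := hi
  exact ⟨p, hp, fun j => h.trans (hfar j)⟩

/-- Exposure is MONOTONE in the search radius. -/
theorem exposed_mono {r₀ R R' : ℝ} (h : R ≤ R') {y : Fin N → E3} {i : Fin N} (hi : Exposed r₀ R y i) :
    Exposed r₀ R' y i := by
  obtain ⟨p, hp, hfar⟩ := hi
  exact ⟨p, hp.trans h, hfar⟩

/-! ## §2 The packing lemma: sparse matter is exposed at hole scale `s/(s+1)` -/

/-- Membership in the closed-ball chunk `ballChunk y c R` is `dist (y k) (y c) ≤ R`. [folklore] -/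
theorem mem_ballChunk {y : Fin N → E3} {c k : Fin N} {R : ℝ} : k ∈ ballChunk y c R ↔ dist (y k) (y c) ≤ R := by
  simp [ballChunk]

/-- `¬ Sparse s y` iff SOME closed `s`-ball about a particle holds at least `s³` particles (the filling clause of `DeepFar`). -/
theorem not_sparse_iff {s : ℝ} {y : Fin N → E3} : ¬ Sparse s y ↔ ∃ i : Fin N, s ^ 3 ≤ ((ballChunk y i s).card : ℝ) := by
  simp [Sparse, not_lt]

/-- **PACKING LEMMA (PROVED).**  If the closed `s`-ball about `y i` holds fewer than `s³` particles and `0 < r₀`, `s·r₀ ≤ s − r₀`,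
then `y i` is `(r₀, s − r₀)`-exposed: the `< s³` open `r₀`-balls about the particles of the `s`-ball have total volume
`< s³·r₀³·|B₁| ≤ (s − r₀)³·|B₁| = |B̄(y i, s − r₀)|`, so they cannot cover that closed ball, and a particle outside the `s`-ball is at
distance `> s − (s − r₀) = r₀` from every point of it. -/
theorem exposed_of_card_lt {s r₀ : ℝ} (hr : 0 < r₀) (hR : s * r₀ ≤ s - r₀) {y : Fin N → E3} {i : Fin N}
    (hcard : ((ballChunk y i s).card : ℝ) < s ^ 3) : Exposed r₀ (s - r₀) y i := by
  classical
  have hs : 0 < s := by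
    by_contra h
    push Not at h
    have h3 : s ^ 3 ≤ 0 := Odd.pow_nonpos (by decide) h
    have h0 : (0 : ℝ) ≤ ((ballChunk y i s).card : ℝ) := Nat.cast_nonneg _
    linarith
  have hsr : 0 < s * r₀ := mul_pos hs hr
  have hR₀ : 0 < s - r₀ := lt_of_lt_of_le hsr hR
  by_contra hne
  simp only [Exposed, not_exists, not_and, not_forall, not_le] at hne
  -- every point of the closed `(s − r₀)`-ball is within `r₀` of a particle of the `s`-ball chunk
  have hsub : Metric.closedBall (y i) (s - r₀) ⊆ ⋃ j ∈ ballChunk y i s, Metric.ball (y j) r₀ := by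
    intro p hp
    rw [Metric.mem_closedBall] at hp
    obtain ⟨j, hj⟩ := hne p hp
    have hjmem : j ∈ ballChunk y i s := by
      rw [mem_ballChunk]
      have h1 := dist_triangle (y j) p (y i)
      rw [dist_comm (y j) p] at h1
      linarith
    exact Set.mem_biUnion hjmem (Metric.mem_ball.2 hj)
  have hV0 : volume (Metric.ball (0 : E3) 1) ≠ 0 := (Metric.measure_ball_pos volume (0 : E3) one_pos).ne'
  have hVtop : volume (Metric.ball (0 : E3) 1) ≠ ⊤ := measure_ball_lt_top.ne
  have hdim : Module.finrank ℝ E3 = 3 := finrank_euclideanSpace_fin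
  have hball : ∀ j : Fin N, volume (Metric.ball (y j) r₀) = ENNReal.ofReal (r₀ ^ 3) * volume (Metric.ball (0 : E3) 1) := by
    intro j
    rw [Measure.addHaar_ball_of_pos volume (y j) hr, hdim]
  have hcb : volume (Metric.closedBall (y i) (s - r₀)) = ENNReal.ofReal ((s - r₀) ^ 3) * volume (Metric.ball (0 : E3) 1) := by
    rw [Measure.addHaar_closedBall volume (y i) hR₀.le, hdim]
  have hU : volume (⋃ j ∈ ballChunk y i s, Metric.ball (y j) r₀) ≤
      ∑ j ∈ ballChunk y i s, volume (Metric.ball (y j) r₀) :=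
    measure_biUnion_finset_le _ _
  simp only [hball, Finset.sum_const, nsmul_eq_mul] at hU
  -- the real inequality `#chunk · r₀³ < (s − r₀)³`
  have hkey : ((ballChunk y i s).card : ℝ) * r₀ ^ 3 < (s - r₀) ^ 3 := by
    have h1 : ((ballChunk y i s).card : ℝ) * r₀ ^ 3 < s ^ 3 * r₀ ^ 3 :=
      mul_lt_mul_of_pos_right hcard (pow_pos hr 3)
    have h2 : s ^ 3 * r₀ ^ 3 = (s * r₀) ^ 3 := by ring
    have h3 : (s * r₀) ^ 3 ≤ (s - r₀) ^ 3 := pow_le_pow_left₀ hsr.le hR 3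
    linarith
  have hlt : ((ballChunk y i s).card : ENNReal) * (ENNReal.ofReal (r₀ ^ 3) * volume (Metric.ball (0 : E3) 1)) <
      ENNReal.ofReal ((s - r₀) ^ 3) * volume (Metric.ball (0 : E3) 1) := by
    have hof : ((ballChunk y i s).card : ENNReal) * ENNReal.ofReal (r₀ ^ 3) < ENNReal.ofReal ((s - r₀) ^ 3) := by
      rw [← ENNReal.ofReal_natCast, ← ENNReal.ofReal_mul (Nat.cast_nonneg _)]
      exact (ENNReal.ofReal_lt_ofReal_iff (pow_pos hR₀ 3)).2 hkey
    calc ((ballChunk y i s).card : ENNReal) * (ENNReal.ofReal (r₀ ^ 3) * volume (Metric.ball (0 : E3) 1))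
        = volume (Metric.ball (0 : E3) 1) * (((ballChunk y i s).card : ENNReal) * ENNReal.ofReal (r₀ ^ 3)) := by ring
      _ < volume (Metric.ball (0 : E3) 1) * ENNReal.ofReal ((s - r₀) ^ 3) := ENNReal.mul_lt_mul_right hV0 hVtop hof
      _ = ENNReal.ofReal ((s - r₀) ^ 3) * volume (Metric.ball (0 : E3) 1) := mul_comm _ _
  have hchain := lt_of_le_of_lt ((measure_mono hsub).trans hU) hlt
  rw [hcb] at hchain
  exact lt_irrefl _ hchain

/-- **Every particle of an `s`-sparse configuration is `(r₀, s − r₀)`-exposed** (`0 < r₀`, `s·r₀ ≤ s − r₀`). -/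
theorem exposed_of_sparse {s r₀ : ℝ} (hr : 0 < r₀) (hR : s * r₀ ≤ s - r₀) {y : Fin N → E3} (h : Sparse s y) (i : Fin N) :
    Exposed r₀ (s - r₀) y i :=
  exposed_of_card_lt hr hR (h i)

/-- At the frozen numeral `s = 32`: a `32`-sparse configuration is `(32/33, 1024/33)`-exposed at EVERY particle. -/
theorem exposed_of_sparse32 {y : Fin N → E3} (h : Sparse 32 y) (i : Fin N) : Exposed (32 / 33) (1024 / 33) y i := by
  have h' := exposed_of_sparse (s := 32) (r₀ := 32 / 33) (by norm_num) (by norm_num) h i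
  rwa [show (32 : ℝ) - 32 / 33 = 1024 / 33 by norm_num] at h'

/-- A particle with NO empty `r₀`-ball centred within `s − r₀` sits in a FILLED `s`-ball (contrapositive of the packing lemma). -/
theorem card_ge_of_not_exposed {s r₀ : ℝ} (hr : 0 < r₀) (hR : s * r₀ ≤ s - r₀) {y : Fin N → E3} {i : Fin N}
    (hi : ¬ Exposed r₀ (s - r₀) y i) : s ^ 3 ≤ ((ballChunk y i s).card : ℝ) :=
  le_of_not_gt fun h => hi (exposed_of_card_lt hr hR h)

/-! ## §3 Cohesion statements and the empty TENUOUS world -/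

/-- **`NoSparseGS s`** [SUFFICIENT for TENUOUS (`tenuousCertified_of_noSparseGS`) · sieve-free, `AllFar`-free, `e⋆`-free, `μ`-free,
surgery-free · the pure COHESION reading of the residual core: beyond some particle number NO Lennard-Jones ground state is everywhere
`s`-sparse — some closed `s`-ball about a particle holds at least `s³` particles (at `s = 32`: `≥ 15.5 %` of the close-packed count
somewhere) · BARRIER: its enemies are extended ground states below `3/(4π) ≈ 0.24` number density at scale `s` EVERYWHERE — foams,
sponges, fibres, films of < 7 close-packed layers — crystalline OR amorphous; excluding them is surface tension / exposed-sites cost at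
hole scale `s/(s+1)` (`noSparseGS_of_costAt`), the one-centre-slack barrier of every bulk route, NOT tetrahedral frustration]. [line vocabulary · LoopTunnelDial cohesion dial · crux stmt-AtomisticToContinuum-27294 · definition, not a cited fact] -/
def NoSparseGS (s : ℝ) : Prop :=
  ∃ N₁ : ℕ, ∀ N : ℕ, N₁ ≤ N → ∀ y : Fin N → E3, IsGroundState lennardJones y → ¬ Sparse s y

/-- **`CohesiveCoreGS r₀ R`** [SUFFICIENT for `NoSparseGS s` when `R = s − r₀`, `s·r₀ ≤ s − r₀` (`noSparseGS_of_cohesiveCore`) ·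
GS-geometric, energy-free]: beyond some particle number every Lennard-Jones ground state has a particle with NO empty open `r₀`-ball
centred within distance `R` of it (an `(r₀, R)`-cohesive core). [line vocabulary · LoopTunnelDial cohesion dial · crux stmt-AtomisticToContinuum-27294 · definition, not a cited fact] -/
def CohesiveCoreGS (r₀ R : ℝ) : Prop :=
  ∃ N₁ : ℕ, ∀ N : ℕ, N₁ ≤ N → ∀ y : Fin N → E3, IsGroundState lennardJones y → ∃ i : Fin N, ¬ Exposed r₀ R y i

/-- **`ExposedFractionSmall r₀ R`** — the UNIFORM fixed-scale no-foam law: for every `ε > 0`, beyond some particle number every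
Lennard-Jones ground state has at most `ε·N` particles that are `(r₀, R)`-exposed. [line vocabulary · LoopTunnelDial cohesion dial · crux stmt-AtomisticToContinuum-27294 · definition, not a cited fact] -/
def ExposedFractionSmall (r₀ R : ℝ) : Prop :=
  ∀ ε : ℝ, 0 < ε → ∃ N₁ : ℕ, ∀ N : ℕ, N₁ ≤ N → ∀ y : Fin N → E3, IsGroundState lennardJones y →
    (Nat.card {i : Fin N // Exposed r₀ R y i} : ℝ) ≤ ε * N

/-- **`ExposedSitesCostAt r₀`** — route `SurfaceTensionNoFoam`'s rank-2 crux `ExposedSitesCost` (stmt-AtomisticToContinuum-13448) AT A FIXED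
HOLE SCALE `r₀` (its body VERBATIM after `∃ r₀ : ℝ, 0 < r₀ ∧`): for every `R > 0` some `c > 0` prices every `(r₀, R)`-exposed particle of
every Lennard-Jones ground state against the periodic infimum, `c·#exposed ≤ E(N) − N·⨅_Q e(Q)`.  [BARRIER-core: one-centre slack at
`e⋆` (card of 13448); STRONGER than 13448 for each fixed `r₀` (`∃`-introduction), monotone in `r₀` (`costAt_mono`); physically true
exactly for `r₀` above the covering radius `≈ 0.69` of the close packings — at `r₀ = 32/33 < 0.971` it also prices monovacancy shells]. [line vocabulary · LoopTunnelDial cohesion dial · crux stmt-AtomisticToContinuum-27294 · definition, not a cited fact] -/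
def ExposedSitesCostAt (r₀ : ℝ) : Prop :=
  ∀ R : ℝ, 0 < R → ∃ c : ℝ, 0 < c ∧ ∀ (N : ℕ) (x : Fin N → EuclideanSpace ℝ (Fin 3)),
    IsGroundState lennardJones x →
      c * (Nat.card {i : Fin N // ∃ p : EuclideanSpace ℝ (Fin 3), dist p (x i) ≤ R ∧ ∀ j : Fin N, r₀ ≤ dist p (x j)} : ℝ) ≤
        groundStateEnergy lennardJones 3 N - (N : ℝ) * (⨅ Q : PeriodicConfiguration 3, Q.energyPerParticle lennardJones)

/-- **`NoSparseGS` ⟹ TENUOUS (PROVED: on an EMPTY world every certificate is valid — threshold `N₁`, radius `0`, margin `1`).**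
The landed `TenuousCertified s` of kit 5, with NO separation hypothesis. -/
theorem tenuousCertified_of_noSparseGS {s : ℝ} (h : NoSparseGS s) : TenuousCertified s := by
  obtain ⟨N₁, h⟩ := h
  exact ⟨N₁, 0, 1, le_rfl, one_pos, fun N hN _ y hy _ hsp => absurd hsp (h N hN y hy)⟩

/-- Earnshaw connectivity, BY NAME from the tree (`LjLaminarWindowsSketch.stub_earnshawConnectivity`, landed, sorry-free). -/
theorem earnshawConnected : EarnshawConnected :=
  Summit.AtomisticToContinuum.Crystallization.Theorems.LjLaminarWindowsSketch.stub_earnshawConnectivity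

/-- **THIN ⟸ TOUCH ∧ `NoSparseGS` (PROVED, unconditional).** -/
theorem thinCertified_of_touch_noSparse {s : ℝ} (hT : TouchCertified s) (hS : NoSparseGS s) : ThinCertified s :=
  thinCertified_of_touch_tenuous earnshawConnected hT (tenuousCertified_of_noSparseGS hS)

/-- **`CohesiveCoreGS r₀ (s − r₀)` ⟹ `NoSparseGS s` (PROVED, the packing lemma).** -/
theorem noSparseGS_of_cohesiveCore {s r₀ : ℝ} (hr : 0 < r₀) (hR : s * r₀ ≤ s - r₀) (h : CohesiveCoreGS r₀ (s - r₀)) :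
    NoSparseGS s := by
  obtain ⟨N₁, h⟩ := h
  refine ⟨N₁, fun N hN y hy hsp => ?_⟩
  obtain ⟨i, hi⟩ := h N hN y hy
  exact hi (exposed_of_sparse hr hR hsp i)

/-- **`ExposedFractionSmall` ⟹ `CohesiveCoreGS` (PROVED: at `ε = 1/2` not every particle is exposed).** -/
theorem cohesiveCore_of_fractionSmall {r₀ R : ℝ} (h : ExposedFractionSmall r₀ R) : CohesiveCoreGS r₀ R := by
  obtain ⟨N₁, hN₁⟩ := h (1 / 2) (by norm_num)
  refine ⟨max N₁ 1, fun N hN y hy => ?_⟩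
  have hN1 : N₁ ≤ N := (le_max_left _ _).trans hN
  have hNpos : 1 ≤ N := (le_max_right _ _).trans hN
  by_contra hall
  push Not at hall
  have hcard : Nat.card {i : Fin N // Exposed r₀ R y i} = N := by
    rw [Nat.card_congr (Equiv.subtypeUnivEquiv hall), Nat.card_eq_fintype_card, Fintype.card_fin]
  have hle := hN₁ N hN1 y hy
  rw [hcard] at hle
  have h1 : (1 : ℝ) ≤ N := by exact_mod_cast hNpos
  linarith

/-- **`ExposedSitesCostAt r₀` ⟹ `ExposedFractionSmall r₀ R` (PROVED; squeeze against the LANDED `E(N)/N → e⋆`, item 0626).** -/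
theorem fractionSmall_of_costAt {r₀ R : ℝ} (hR : 0 < R) (h : ExposedSitesCostAt r₀) : ExposedFractionSmall r₀ R := by
  intro ε hε
  obtain ⟨c, hc, hcN⟩ := h R hR
  have hlim : Tendsto (fun N : ℕ => groundStateEnergy lennardJones 3 N / N) atTop (𝓝 eStar) := crysEnergyLimit
  have hev : ∀ᶠ N : ℕ in atTop, groundStateEnergy lennardJones 3 N / N < eStar + c * ε :=
    hlim.eventually (Iio_mem_nhds (by nlinarith [mul_pos hc hε]))
  obtain ⟨N₁, hN₁⟩ := eventually_atTop.1 hev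
  refine ⟨N₁, fun N hN y hy => ?_⟩
  have hE : c * (Nat.card {i : Fin N // Exposed r₀ R y i} : ℝ) ≤ groundStateEnergy lennardJones 3 N - (N : ℝ) * eStar :=
    hcN N y hy
  rcases Nat.eq_zero_or_pos N with hN0 | hNpos
  · subst hN0
    simp
  have hNr : (0 : ℝ) < N := by exact_mod_cast hNpos
  have h1 : groundStateEnergy lennardJones 3 N / N < eStar + c * ε := hN₁ N hN
  rw [div_lt_iff₀ hNr] at h1
  have h3 : c * (Nat.card {i : Fin N // Exposed r₀ R y i} : ℝ) < c * (ε * N) := by linarith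
  exact (lt_of_mul_lt_mul_left h3 hc.le).le

/-- **`ExposedSitesCostAt r₀` ⟹ `NoSparseGS s` for every hole scale `0 < r₀` with `s·r₀ ≤ s − r₀` (PROVED; `0 < s`).** -/
theorem noSparseGS_of_costAt {s r₀ : ℝ} (hs : 0 < s) (hr : 0 < r₀) (hR : s * r₀ ≤ s - r₀) (h : ExposedSitesCostAt r₀) :
    NoSparseGS s :=
  noSparseGS_of_cohesiveCore hr hR
    (cohesiveCore_of_fractionSmall (fractionSmall_of_costAt (lt_of_lt_of_le (mul_pos hs hr) hR) h))

/-- **At the frozen numeral:** `ExposedSitesCostAt (32/33) → NoSparseGS 32`. -/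
theorem noSparseGS32_of_costAt (h : ExposedSitesCostAt (32 / 33)) : NoSparseGS 32 :=
  noSparseGS_of_costAt (by norm_num) (by norm_num) (by norm_num) h

/-- … hence TENUOUS at `32`. -/
theorem tenuousCertified32_of_costAt (h : ExposedSitesCostAt (32 / 33)) : TenuousCertified 32 :=
  tenuousCertified_of_noSparseGS (noSparseGS32_of_costAt h)

/-! ## §4 Monotonicity in the hole scale (the direction that matters) -/

/-- A LARGER hole scale is a WEAKER cost law: `ExposedSitesCostAt r₀ → ExposedSitesCostAt r₁` for `r₀ ≤ r₁`. -/
theorem costAt_mono {r₀ r₁ : ℝ} (h01 : r₀ ≤ r₁) (h : ExposedSitesCostAt r₀) : ExposedSitesCostAt r₁ := by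
  intro R hR
  obtain ⟨c, hc, hcN⟩ := h R hR
  refine ⟨c, hc, fun N x hx => le_trans ?_ (hcN N x hx)⟩
  have hle : Nat.card {i : Fin N // ∃ p : EuclideanSpace ℝ (Fin 3), dist p (x i) ≤ R ∧ ∀ j : Fin N, r₁ ≤ dist p (x j)} ≤
      Nat.card {i : Fin N // ∃ p : EuclideanSpace ℝ (Fin 3), dist p (x i) ≤ R ∧ ∀ j : Fin N, r₀ ≤ dist p (x j)} :=
    Nat.card_le_card_of_injective _
      (Subtype.impEmbedding _ _ (fun i hi => exposed_anti (R := R) (y := x) h01 hi)).injective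
  exact mul_le_mul_of_nonneg_left (by exact_mod_cast hle) hc.le

/-- `CohesiveCoreGS` is MONOTONE in the hole scale and ANTITONE in the radius. -/
theorem cohesiveCore_mono {r₀ r₁ R R' : ℝ} (h01 : r₀ ≤ r₁) (hRR : R' ≤ R) (h : CohesiveCoreGS r₀ R) : CohesiveCoreGS r₁ R' := by
  obtain ⟨N₁, h⟩ := h
  refine ⟨N₁, fun N hN y hy => ?_⟩
  obtain ⟨i, hi⟩ := h N hN y hy
  exact ⟨i, fun hi' => hi (exposed_anti h01 (exposed_mono hRR hi'))⟩


end Summit.AtomisticToContinuum.Crystallization.Theorems.LoopTunnelDialCohesionDial
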